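import Summits.AnomalousDissipation.AnomalousDissipation.Theorems.QuarticGate.Negative.EnergyRow
import Summits.AnomalousDissipation.AnomalousDissipation.Theorems.MomentParityQuarticGateDesignSymShiftOp
import Summits.AnomalousDissipation.AnomalousDissipation.Theorems.MomentParityMomentClosure
import Literature.Analysis.FluidPDE.EnergySpaceRellich

/-!
# Haar symmetrisation of a bounded all-order-stationary Galerkin law

Helper file for stub S2 (`stub_haarSymmetrise`) of the line `symmetrised-profile-frozen-quiet-split` of
the crux `MomentParity.GalerkinInvariantLoud` (stmt-AnomalousDissipation-14283).

**Setting.** `T a : H ≃ₜ H` (`a ∈ T³`) is a jointly continuous family of homeomorphisms of the energy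
space `H = L²_σ(T³)` represented a.e. by the translations `u ↦ u(· + a)` (a HYPOTHESIS here; such a
family is produced by stub S1), `f` is a smooth force invariant under the shear torus
`{c : T³ | c 1 = 0}`, and `μ` is a Borel probability law on `H` carried by the level-`N` Galerkin
fields, supported in the ball `‖u‖ ≤ R` and polynomially stationary at every order for Galerkin
Navier–Stokes at `(ν, f)` (`IsPolyStationary ν f N d μ` for all `d`).

**The averaged law.** With the shear projection `π a := (a₀, 0, a₂)` (`Function.update a 1 0`, a
continuous retraction of `T³` onto the shear torus with `π (a - c) = π a - c` for `c 1 = 0`) put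
`Φ (a, u) := T (π a) u` and `μ' := Φ_* (Haar_{T³} ⊗ μ)`. Averaging over all of `T³` through `π`
(rather than over the `2`-torus itself) avoids building the Haar measure of the subgroup: the
push-forward of `Haar_{T³}` under `π` IS the Haar measure of the shear torus.

**The clauses** (`stub_haarSymmetrise`).
* level / radius: `T a` preserves the level property and the norm (`isLevel_shiftOp_iff`,
  `norm_shiftOp`), so `μ'` is carried by the same compact level ball `K` (`isCompact_levelBall`);
  continuous observables are then `μ'`-integrable and `∫ F dμ' = ∫ F ∘ Φ d(Haar ⊗ μ)`;
* stationarity: the row `u ↦ ⟨F(u), ∇p(u)⟩` of a polynomial observable at the translate `T b u`,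
  `b` fixing `f`, is the row at `u` of the same polynomial in the back-translated (again level-`N`
  band, `isBandTest_comp_add_right`) tests (`pairing_shiftOp`, `nsGeneratorPairing_shiftOp`), which
  `μ` annihilates; Fubini;
* translation symmetry in law: for `c 1 = 0`, `(T (π a) u, g(· + c)) = (T (π (a - c)) u, g)` and
  `a ↦ a - c` preserves `Haar_{T³}` (`MeasurePreserving.integral_comp`, no integrability needed);
* energy and dissipation: `‖T a u‖ = ‖u‖`, `‖∇(T a u)‖² = ‖∇u‖²` (`eGradNormSq_shiftOp`) and the second
  marginal of `Haar ⊗ μ` is `μ`.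

## Mathlib / tree search

* Mathlib: `Measure.prod`, `Measure.map`, `Measure.isProbabilityMeasure_map`, `ae_map_iff`,
  `integral_map_of_stronglyMeasurable`, `integrable_map_measure`, `integral_prod`, `integral_fun_snd`,
  `Measure.map_snd_prod`, `lintegral_map`, `Measure.quasiMeasurePreserving_snd`,
  `measurePreserving_sub_right`, `MeasurePreserving.prod`, `MeasurableEquiv.prodCongr`,
  `MeasurableEquiv.subRight`, `Continuous.update`.
* Tree: `Theorems.MomentParityQuarticGate.{pairing_shiftOp, nsGeneratorPairing_shiftOp, norm_shiftOp,
  eGradNormSq_shiftOp, isLevel_shiftOp_iff, isBandTest_comp_add_right}`,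
  `Theorems.MomentParityMomentClosure.{isCompact_levelBall, continuous_nsGeneratorPairing_polyGrad,
  continuous_eval_pderiv, integrable_of_continuous_of_ae_mem}`,
  `Torus.lowerSemicontinuous_eGradNormSq_coe`, `Torus.IsSmooth.integrable`, `Torus.IsSmooth.comp_add_right`.
-/

namespace Summit.AnomalousDissipation.AnomalousDissipation.Theorems.GalerkinInvariantLoud.HaarSymmetrise

open MeasureTheory Filter Topology
open scoped ENNReal InnerProductSpace RealInnerProductSpace
open Literature.Analysis.FunctionSpaces Literature.Analysis.FluidPDE
open Summit.AnomalousDissipation.AnomalousDissipation.Theorems.QuarticGate.Negative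
open Summit.AnomalousDissipation.AnomalousDissipation.Theorems.CubicParityLoud.Negative (T3 R3 H3 L2T3 frameG)

set_option linter.dupNamespace false

noncomputable section

/-! ## The shear projection `π a = (a₀, 0, a₂)` -/

/-- The shear projection `a ↦ (a₀, 0, a₂)` of `T³` onto the shear torus `{c | c 1 = 0}` is continuous.
[folklore] -/
theorem continuous_shearProj : Continuous fun a : T3 => Function.update a 1 (0 : UnitAddCircle) :=
  continuous_id.update 1 continuous_const

/-- The shear projection lands in the shear torus: `(π a) 1 = 0`. [folklore] -/
theorem shearProj_apply_one (a : T3) : Function.update a 1 (0 : UnitAddCircle) 1 = 0 :=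
  Function.update_self _ _ _

/-- The shear projection commutes with shear translations: `π (a - c) = π a - c` whenever `c 1 = 0`.
[folklore] -/
theorem shearProj_sub (a : T3) {c : T3} (hc : c 1 = 0) :
    Function.update (a - c) 1 (0 : UnitAddCircle) = Function.update a 1 (0 : UnitAddCircle) - c := by
  funext i
  by_cases hi : i = 1
  · subst hi
    simp [hc]
  · simp [Function.update_of_ne hi]

/-! ## Covariance of the stationarity rows under an a.e.-translation family -/

section Covariance

variable {T : T3 → H3 ≃ₜ H3}
  (hT : ∀ (a : T3) (u : H3), ((T a u).1 : T3 → R3) =ᵐ[volume] fun x => (u.1 : T3 → R3) (x + a))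

include hT

/-- **Rows at a translate are rows at the back-translated tests.** For a translation `b` fixing the
force, `⟨F(T_b u), ∇p_g(T_b u)⟩ = ⟨F(u), ∇p_{g(· - b)}(u)⟩`: the coefficients `∂ᵢP((T_b u, g₁), …)` equal
`∂ᵢP((u, g₁(· - b)), …)` (`pairing_shiftOp`) and the generator row is covariant
(`nsGeneratorPairing_shiftOp`). [folklore] -/
theorem row_shiftOp (ν : ℝ) {f : T3 → R3} {b : T3} (hfb : ∀ x, f (x + b) = f x) {m : ℕ}
    (g : Fin m → T3 → R3) (P : MvPolynomial (Fin m) ℝ) (u : H3) :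
    Torus.nsGeneratorPairing ν f (T b u) (polyGrad g P (T b u)) =
      Torus.nsGeneratorPairing ν f u (polyGrad (fun i x => g i (x + -b)) P u) := by
  rw [MomentParityQuarticGate.nsGeneratorPairing_shiftOp hT ν hfb]
  congr 1
  funext x
  simp only [polyGrad, MomentParityQuarticGate.pairing_shiftOp hT, sub_eq_add_neg]

/-- **Translates of an all-order stationary law have vanishing rows.** If `μ` is polynomially
stationary at every order for Galerkin NS at `(ν, f)` and level `N`, and `b` fixes `f`, then every
row evaluated at `T_b u` is `μ`-integrable with zero mean (stationarity of `μ` at the back-translated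
band tests, `isBandTest_comp_add_right`). [folklore] -/
theorem row_shiftOp_integral (ν : ℝ) {f : T3 → R3} {b : T3} (hfb : ∀ x, f (x + b) = f x) {N : ℕ}
    {μ : Measure H3} (hS : ∀ d, IsPolyStationary ν f N d μ) {m : ℕ} {g : Fin m → T3 → R3}
    (hg : ∀ i, IsBandTest N (g i)) (P : MvPolynomial (Fin m) ℝ) :
    Integrable (fun u => Torus.nsGeneratorPairing ν f (T b u) (polyGrad g P (T b u))) μ ∧
      ∫ u, Torus.nsGeneratorPairing ν f (T b u) (polyGrad g P (T b u)) ∂μ = 0 := by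
  simp only [row_shiftOp hT ν hfb]
  exact hS (P.totalDegree + 1) m (fun i x => g i (x + -b)) P
    (fun i => MomentParityQuarticGate.isBandTest_comp_add_right (hg i) (-b)) le_rfl

/-- **Cylindrical moments at shear-translated tests.** For a retraction `π` with `π (a - c) = π a - c`,
`P((T_{π a} u, g₁(· + c)), …) = P((T_{π (a - c)} u, g₁), …)` (`pairing_shiftOp` twice). [folklore] -/
theorem eval_pairing_shiftOp_comp_add {π : T3 → T3} {a c : T3} (hπ : π (a - c) = π a - c) {m : ℕ}
    (g : Fin m → T3 → R3) (P : MvPolynomial (Fin m) ℝ) (u : H3) :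
    MvPolynomial.eval (fun i => Torus.pairing (T (π a) u).1 (fun x => g i (x + c))) P =
      MvPolynomial.eval (fun i => Torus.pairing (T (π (a - c)) u).1 (g i)) P := by
  have key : (fun i => Torus.pairing (T (π a) u).1 (fun x => g i (x + c))) =
      fun i => Torus.pairing (T (π (a - c)) u).1 (g i) := by
    funext i
    simp only [MomentParityQuarticGate.pairing_shiftOp hT, hπ, sub_sub_eq_add_sub, sub_add_eq_add_sub]
  rw [key]

end Covariance

/-! ## The stub -/

/-- **S2 · `stub_haarSymmetrise` — Haar averaging over the shear torus is free.** Given a jointly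
continuous family `T a : H ≃ₜ H` of homeomorphisms represented a.e. by `u ↦ u(· + a)`, a smooth force
invariant under `{c : c 1 = 0}`, and a probability law `μ` on `H` that is level-`N` carried, supported
in `‖u‖ ≤ R` and polynomially stationary at every order for Galerkin NS at `(ν, f)`, the law
`μ' := Φ_* (Haar_{T³} ⊗ μ)`, `Φ (a, u) := T (a₀, 0, a₂) u`, is a probability law, level-`N` carried,
supported in the same ball, stationary at every order, TRANSLATION SYMMETRIC IN LAW under the shear
torus (every polynomial cylindrical moment with level-`N` band tests is unchanged under
`g ↦ g(· + c)`, `c 1 = 0`), with the same mean energy and the same dissipation (module docstring).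
[folklore] -/
theorem stub_haarSymmetrise :
    ∀ (T : T3 → H3 ≃ₜ H3),
      (∀ (a : T3) (u : H3), ((T a u).1 : T3 → R3) =ᵐ[volume] fun x => (u.1 : T3 → R3) (x + a)) →
      Continuous (fun p : T3 × H3 => T p.1 p.2) →
      ∀ (ν : ℝ) (f : T3 → R3) (N : ℕ) (R : ℝ) (μ : Measure H3), Torus.IsSmooth f →
        (∀ c : T3, c 1 = 0 → ∀ x, f (x + c) = f x) →
        IsProbabilityMeasure μ → (∀ᵐ u ∂μ, IsLevel N u) → (∀ᵐ u ∂μ, ‖u‖ ≤ R) →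
        (∀ d, IsPolyStationary ν f N d μ) →
        ∃ μ' : Measure H3, IsProbabilityMeasure μ' ∧ (∀ᵐ u ∂μ', IsLevel N u) ∧ (∀ᵐ u ∂μ', ‖u‖ ≤ R) ∧
          (∀ d, IsPolyStationary ν f N d μ') ∧
          (∀ c : T3, c 1 = 0 → ∀ (m : ℕ) (g : Fin m → T3 → R3) (P : MvPolynomial (Fin m) ℝ),
            (∀ i, IsBandTest N (g i)) →
              ∫ u, MvPolynomial.eval (fun i => Torus.pairing u.1 (g i)) P ∂μ' =
                ∫ u, MvPolynomial.eval (fun i => Torus.pairing u.1 (fun x => g i (x + c))) P ∂μ') ∧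
          Torus.ensembleEnergy μ' = Torus.ensembleEnergy μ ∧
          Torus.ensembleDissipation ν μ' = Torus.ensembleDissipation ν μ := by
  intro T hT hTc ν f N R μ hf hfinv hμP hl hR hS
  haveI := hμP
  -- short-circuit instance searches on `H` (no `Countable H` / `SecondCountableTopology H` detours)
  haveI : IsFiniteMeasure μ := ⟨by rw [measure_univ]; exact ENNReal.one_lt_top⟩
  haveI : SigmaFinite μ := IsFiniteMeasure.toSigmaFinite μ
  haveI : SFinite μ := instSFiniteOfSigmaFinite
  haveI : SecondCountableTopologyEither T3 H3 := secondCountableTopologyEither_of_left T3 H3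
  -- the shear projection `π a = (a₀, 0, a₂)` and its three properties
  obtain ⟨π, hπc, hπ1, hπsub⟩ : ∃ π : T3 → T3, Continuous π ∧ (∀ a, π a 1 = 0) ∧
      ∀ a c : T3, c 1 = 0 → π (a - c) = π a - c :=
    ⟨fun a => Function.update a 1 0, continuous_shearProj, shearProj_apply_one,
      fun a _ hc => shearProj_sub a hc⟩
  have hfπ : ∀ (a : T3) (x : T3), f (x + π a) = f x := fun a => hfinv (π a) (hπ1 a)
  -- the averaging map `Φ (a, u) = T (π a) u` and the law `μ' = Φ_* (Haar ⊗ μ)`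
  obtain ⟨Φ, hΦ⟩ : ∃ Φ : T3 × H3 → H3, ∀ p, Φ p = T (π p.1) p.2 := ⟨_, fun _ => rfl⟩
  have hΦc : Continuous Φ := by
    rw [show Φ = fun p => T (π p.1) p.2 from funext hΦ]
    exact hTc.comp ((hπc.comp continuous_fst).prodMk continuous_snd)
  have hΦm : Measurable Φ := hΦc.measurable
  refine ⟨Measure.map Φ ((volume : Measure T3).prod μ),
    Measure.isProbabilityMeasure_map hΦm.aemeasurable, ?_⟩
  -- the compact carrier `K` of `μ` and of `μ'`
  have hR0 : 0 ≤ R := by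
    obtain ⟨u, hu⟩ := hR.exists
    exact (norm_nonneg u).trans hu
  set K : Set H3 := {u : H3 | IsLevel N u ∧ ‖u‖ ≤ R} with hK_def
  have hK : IsCompact K := MomentParityMomentClosure.isCompact_levelBall N hR0
  have hρK : ∀ᵐ p ∂((volume : Measure T3).prod μ), Φ p ∈ K := by
    have h2 : ∀ᵐ p ∂((volume : Measure T3).prod μ), IsLevel N p.2 ∧ ‖p.2‖ ≤ R :=
      Measure.quasiMeasurePreserving_snd.ae (hl.and hR)
    refine h2.mono fun p hp => ?_
    rw [hΦ p]
    exact ⟨(MomentParityQuarticGate.isLevel_shiftOp_iff hT N (π p.1) p.2).2 hp.1,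
      (MomentParityQuarticGate.norm_shiftOp hT (π p.1) p.2).le.trans hp.2⟩
  have hμ'K : ∀ᵐ v ∂(Measure.map Φ ((volume : Measure T3).prod μ)), v ∈ K :=
    (ae_map_iff hΦm.aemeasurable hK.isClosed.measurableSet).2 hρK
  -- integrals of continuous observables against `μ'`
  have hint : ∀ {F : H3 → ℝ}, Continuous F → Integrable F (Measure.map Φ ((volume : Measure T3).prod μ)) :=
    fun hF => MomentParityMomentClosure.integrable_of_continuous_of_ae_mem hK hμ'K hF
  have hintρ : ∀ {F : H3 → ℝ}, Continuous F →
      Integrable (fun p => F (Φ p)) ((volume : Measure T3).prod μ) :=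
    fun hF => (integrable_map_measure hF.aestronglyMeasurable hΦm.aemeasurable).1 (hint hF)
  have hmap : ∀ {F : H3 → ℝ}, Continuous F →
      ∫ v, F v ∂(Measure.map Φ ((volume : Measure T3).prod μ)) =
        ∫ p, F (Φ p) ∂((volume : Measure T3).prod μ) :=
    fun hF => integral_map_of_stronglyMeasurable hΦm hF.stronglyMeasurable
  have hfi : Integrable f volume := hf.integrable
  refine ⟨hμ'K.mono fun v hv => hv.1, hμ'K.mono fun v hv => hv.2, ?_, ?_, ?_, ?_⟩
  · -- stationarity at every order: rows of `(T (π a))_* μ` vanish for every `a`; Fubini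
    intro d m g P hg _
    have hrc : Continuous fun u : H3 => Torus.nsGeneratorPairing ν f u (polyGrad g P u) :=
      MomentParityMomentClosure.continuous_nsGeneratorPairing_polyGrad ν hfi (fun i => (hg i).1) P
    refine ⟨hint hrc, ?_⟩
    rw [hmap hrc, integral_prod _ (hintρ hrc)]
    have hrow : ∀ a : T3,
        ∫ u, Torus.nsGeneratorPairing ν f (Φ (a, u)) (polyGrad g P (Φ (a, u))) ∂μ = 0 := fun a => by
      simp only [hΦ]
      exact (row_shiftOp_integral hT ν (hfπ a) hS hg P).2
    simp only [hrow, integral_zero]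
  · -- translation symmetry in law under the shear torus
    intro c hc m g P hg
    have hQ : Continuous fun u : H3 => MvPolynomial.eval (fun i => Torus.pairing u.1 (g i)) P :=
      MomentParityMomentClosure.continuous_eval_pderiv (fun i => (hg i).1) P
    have hQc : Continuous fun u : H3 =>
        MvPolynomial.eval (fun i => Torus.pairing u.1 (fun x => g i (x + c))) P :=
      MomentParityMomentClosure.continuous_eval_pderiv (g := fun i x => g i (x + c))
        (fun i => (hg i).1.comp_add_right c) P
    rw [hmap hQ, hmap hQc]
    -- `a ↦ a - c` preserves `Haar ⊗ μ`
    have he : MeasurePreserving (fun p : T3 × H3 => (p.1 - c, p.2)) ((volume : Measure T3).prod μ)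
        ((volume : Measure T3).prod μ) :=
      (measurePreserving_sub_right (volume : Measure T3) c).prod (MeasurePreserving.id μ)
    have hemb : MeasurableEmbedding fun p : T3 × H3 => (p.1 - c, p.2) :=
      (MeasurableEquiv.prodCongr (MeasurableEquiv.subRight c) (MeasurableEquiv.refl H3)).measurableEmbedding
    have key : ∀ p : T3 × H3,
        MvPolynomial.eval (fun i => Torus.pairing (Φ p).1 (fun x => g i (x + c))) P =
          MvPolynomial.eval (fun i => Torus.pairing (Φ (p.1 - c, p.2)).1 (g i)) P := fun p => by
      simp only [hΦ]
      exact eval_pairing_shiftOp_comp_add hT (hπsub p.1 c hc) g P p.2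
    simp only [key]
    exact (he.integral_comp hemb fun p : T3 × H3 =>
      MvPolynomial.eval (fun i => Torus.pairing (Φ p).1 (g i)) P).symm
  · -- mean energy: `‖T a u‖ = ‖u‖` and the second marginal of `Haar ⊗ μ` is `μ`
    unfold Torus.ensembleEnergy
    rw [hmap (F := fun u : H3 => ‖u‖ ^ 2) (continuous_norm.pow 2)]
    have h1 : (fun p : T3 × H3 => ‖Φ p‖ ^ 2) = fun p => ‖p.2‖ ^ 2 := funext fun p => by
      rw [hΦ p, MomentParityQuarticGate.norm_shiftOp hT]
    rw [h1, integral_fun_snd (fun u : H3 => ‖u‖ ^ 2), probReal_univ, one_smul]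
  · -- dissipation: `‖∇(T a u)‖² = ‖∇u‖²` and the second marginal of `Haar ⊗ μ` is `μ`
    have he : Measurable fun u : H3 =>
        Torus.eGradNormSq ((u.1 : Lp R3 2 (volume : Measure T3)) : T3 → R3) :=
      Torus.lowerSemicontinuous_eGradNormSq_coe.measurable
    have hlin : ∫⁻ u, Torus.eGradNormSq ((u.1 : Lp R3 2 (volume : Measure T3)) : T3 → R3)
          ∂(Measure.map Φ ((volume : Measure T3).prod μ)) =
        ∫⁻ u, Torus.eGradNormSq ((u.1 : Lp R3 2 (volume : Measure T3)) : T3 → R3) ∂μ := by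
      rw [lintegral_map he hΦm]
      have h1 : (fun p : T3 × H3 =>
          Torus.eGradNormSq (((Φ p).1 : Lp R3 2 (volume : Measure T3)) : T3 → R3)) =
          fun p => Torus.eGradNormSq (((p.2).1 : Lp R3 2 (volume : Measure T3)) : T3 → R3) :=
        funext fun p => by rw [hΦ p, MomentParityQuarticGate.eGradNormSq_shiftOp hT]
      rw [h1, ← lintegral_map he measurable_snd, Measure.map_snd_prod, measure_univ, one_smul]
    unfold Torus.ensembleDissipation Torus.ensembleEnstrophy
    rw [hlin]

end

end Summit.AnomalousDissipation.AnomalousDissipation.Theorems.GalerkinInvariantLoud.HaarSymmetrise
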